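import Literature.MathematicalPhysics.QuantumLattice.HubbardGridFieldSubstitution

/-!
# Route `KLProgramme`, crux K3 — engine-flow child (stmt-HubbardSuperconductivity-20437), stub (C) at `n = 0`, located item #22a «(C)-SCALE0-PT2»,
# the FAR-SITE supplier, piece (F-b): DISCRETE PARSEVAL ON THE TIME GRID for finite trigonometric sums

Seat hubbard-kl-k3c5-p1 (g14; owner of #22a).  The far-site remainder `hfar` of the record reader (`…FlowReadScaleZeroSunsetCertRows.sunsetRows_of_certV3`)
is to be supplied WITHOUT profiles and WITHOUT a time-decay estimate (KL STATUS 2026-08-28, FAR-SITES-NOTE-g14 §4): by D7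
(`gridCov_hubbardCovAboveCT_apply_eq_sum_freqTerm`) an off-site covariance entry is a trigonometric sum in the time difference,
`A(z; j₁, j₀) = Σ_{i : MatsubaraIdx M} e^{iω_i(τ_{j₁} − τ_{j₀})}·c_i(z)`, `ω_i = π(2nᵢ+1)/β`, `τ_j = jβ/4M`, and the `2M` odd integers `2nᵢ+1` are distinct
modulo `8M`, so the phases are ORTHOGONAL over the `4M` grid times: `Σ_{j₁} ‖A(z; j₁, j₀)‖² = 4M·Σ_i ‖c_i(z)‖²` — exactly the row currency `4M`, no decay in
time needed.  This file proves the generic identity: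
* `sum_cexp_mul_geom` — `Σ_{j<N} r^j` for `r = e^{iθ}` with `e^{iθN} = 1`: `= N` if `e^{iθ} = 1`, `= 0` otherwise;
* **`sum_norm_sq_trigSum_eq`** — for phases `θ_i` with `e^{i(θ_i−θ_i′)N} = 1` and `e^{i(θ_i−θ_i′)} ≠ 1` (`i ≠ i′`):
  `Σ_{j<N} ‖Σ_i c_i e^{iθ_i j}‖² = N·Σ_i ‖c_i‖²`;
* **`sum_norm_sq_matsubaraSum_eq`** — the instance `θ_i = ω_i·β/4M`, any base time `j₀`: `Σ_{j₁ : Fin 4M} ‖Σ_i e^{iω_i(τ_{j₁} − τ_{j₀})} c_i‖² = 4M·Σ_i ‖c_i‖²`.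

Pure algebra; no definitions; nothing here asserts (C), any stub of 20437, K3 or superconductivity.
References: BGM 2006 §2.3 (2.17) (the time grid) [cite: BenfattoGiulianiMastropietro2006]; discrete orthogonality of characters [folklore].
-/

noncomputable section

namespace Summit.HubbardSuperconductivity.HubbardSuperconductivity.Theorems.KLRegimeSplit

set_option linter.dupNamespace false -- summit = problem name (single-conjunct summit), D-0017

open Finset Complex Literature.MathematicalPhysics.QuantumLattice
open scoped ComplexConjugate

/-! ## §1 Geometric sums of unimodular ratios over a full period -/

/-- `Σ_{j<N} e^{iθj} = N` if `e^{iθ} = 1`, and `= 0` if `e^{iθ} ≠ 1` but `e^{iθN} = 1`. -/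
theorem sum_cexp_mul_geom (θ : ℝ) (N : ℕ) (hN : cexp (I * θ * N) = 1) :
    ∑ j ∈ Finset.range N, cexp (I * θ * j) = if cexp (I * θ) = 1 then (N : ℂ) else 0 := by
  have hpow : ∀ j : ℕ, cexp (I * θ * j) = cexp (I * θ) ^ j := fun j => by
    rw [← Complex.exp_nat_mul]; ring_nf
  simp_rw [hpow]
  split_ifs with h1
  · simp [h1]
  · rw [geom_sum_eq h1, ← hpow, hN, sub_self, zero_div]

/-! ## §2 Discrete Parseval for a finite trigonometric sum -/

/-- **Discrete Parseval**: phases `θ_i` whose differences are `N`-th roots (`e^{i(θ_i−θ_i′)N} = 1`) and pairwise distinct (`e^{i(θ_i−θ_i′)} ≠ 1`, `i ≠ i′`);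
then `Σ_{j<N} ‖Σ_i c_i e^{iθ_i j}‖² = N·Σ_i ‖c_i‖²`. -/
theorem sum_norm_sq_trigSum_eq {K N : ℕ} (c : Fin K → ℂ) (θ : Fin K → ℝ)
    (hper : ∀ i i' : Fin K, cexp (I * ((θ i - θ i' : ℝ) : ℂ) * N) = 1)
    (hsep : ∀ i i' : Fin K, i ≠ i' → cexp (I * ((θ i - θ i' : ℝ) : ℂ)) ≠ 1) :
    ∑ j ∈ Finset.range N, ‖∑ i, c i * cexp (I * θ i * j)‖ ^ 2 = N * ∑ i, ‖c i‖ ^ 2 := by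
  -- work in `ℂ`: `‖w‖² = w·conj w`
  have key : ∀ j : ℕ, ((‖∑ i, c i * cexp (I * θ i * j)‖ : ℂ) ^ 2 : ℂ) =
      ∑ i, ∑ i', c i * conj (c i') * cexp (I * ((θ i - θ i' : ℝ) : ℂ) * j) := by
    intro j
    rw [← Complex.mul_conj', map_sum, Finset.sum_mul_sum]
    refine Finset.sum_congr rfl fun i _ => Finset.sum_congr rfl fun i' _ => ?_
    rw [map_mul, ← Complex.exp_conj, map_mul, map_mul, Complex.conj_I, Complex.conj_ofReal, map_natCast]
    rw [mul_mul_mul_comm, ← Complex.exp_add]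
    congr 1
    push_cast
    ring
  -- the geometric sums in `j`
  have hgeom : ∀ i i' : Fin K, ∑ j ∈ Finset.range N, c i * conj (c i') * cexp (I * ((θ i - θ i' : ℝ) : ℂ) * j) =
      if i = i' then c i * conj (c i') * N else 0 := by
    intro i i'
    rw [← Finset.mul_sum, sum_cexp_mul_geom _ N (hper i i')]
    by_cases h : i = i'
    · subst h
      simp
    · rw [if_neg (hsep i i' h), if_neg h, mul_zero]
  apply Complex.ofReal_injective
  push_cast
  calc ∑ j ∈ Finset.range N, ((‖∑ i, c i * cexp (I * θ i * j)‖ : ℂ) ^ 2 : ℂ)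
      = ∑ j ∈ Finset.range N, ∑ i, ∑ i', c i * conj (c i') * cexp (I * ((θ i - θ i' : ℝ) : ℂ) * j) :=
        Finset.sum_congr rfl fun j _ => key j
    _ = ∑ i, ∑ i', ∑ j ∈ Finset.range N, c i * conj (c i') * cexp (I * ((θ i - θ i' : ℝ) : ℂ) * j) := by
        rw [Finset.sum_comm]
        exact Finset.sum_congr rfl fun i _ => Finset.sum_comm
    _ = ∑ i, ∑ i', (if i = i' then c i * conj (c i') * N else 0) :=
        Finset.sum_congr rfl fun i _ => Finset.sum_congr rfl fun i' _ => hgeom i i'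
    _ = ∑ i, c i * conj (c i) * N := by
        refine Finset.sum_congr rfl fun i _ => ?_
        rw [Finset.sum_ite_eq, if_pos (Finset.mem_univ _)]
    _ = (N : ℂ) * ∑ i, ((‖c i‖ : ℂ) ^ 2 : ℂ) := by
        rw [Finset.mul_sum]
        refine Finset.sum_congr rfl fun i _ => ?_
        rw [Complex.mul_conj']
        ring

/-! ## §3 The Matsubara window on the `4M` time grid -/

/-- The rotated coefficient has the same norm: `‖e^{−ix}·c‖ = ‖c‖` for real `x`. -/
theorem norm_cexp_neg_I_mul_ofReal_mul (x : ℝ) (c : ℂ) : ‖cexp (-(I * (x : ℂ))) * c‖ = ‖c‖ := by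
  rw [norm_mul, show -(I * (x : ℂ)) = ((-x : ℝ) : ℂ) * I by push_cast; ring, Complex.norm_exp_ofReal_mul_I, one_mul]

/-- **Time-grid Parseval for the Matsubara window**: the `2M` fermionic frequencies `ω_i = π(2nᵢ+1)/β` (`nᵢ = i − M`) on the grid `τ_j = jβ/4M`
(`0 < β`), ANY base time `j₀`: `Σ_{j₁ : Fin 4M} ‖Σ_i e^{iω_i(τ_{j₁} − τ_{j₀})}·c_i‖² = 4M·Σ_i ‖c_i‖²` — the odd integers `2nᵢ+1` are distinct modulo `8M`. -/
theorem sum_norm_sq_matsubaraSum_eq {M : ℕ} {β : ℝ} (hβ : 0 < β) (c : MatsubaraIdx M → ℂ) (j₀ : Fin (2 * (2 * M))) :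
    ∑ j₁ : Fin (2 * (2 * M)), ‖∑ i : MatsubaraIdx M,
        cexp (I * ((matsubaraFreq β M i * (gridTime β (2 * (2 * M)) j₁ - gridTime β (2 * (2 * M)) j₀) : ℝ) : ℂ)) * c i‖ ^ 2 =
      ((2 * (2 * M) : ℕ) : ℝ) * ∑ i, ‖c i‖ ^ 2 := by
  have hN : 0 < 2 * (2 * M) := Fin.pos j₀
  have hNr : (0 : ℝ) < ((2 * (2 * M) : ℕ) : ℝ) := by exact_mod_cast hN
  have hM : 0 < M := by omega
  have hMc : (M : ℂ) ≠ 0 := by exact_mod_cast hM.ne'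
  have hβc : (β : ℂ) ≠ 0 := by exact_mod_cast hβ.ne'
  -- phases `θ_i = ω_i β/4M = π(2nᵢ+1)/4M` and rotated coefficients `c′_i = e^{−iω_iτ_{j₀}} c_i`
  set θ : MatsubaraIdx M → ℝ := fun i => Real.pi * (2 * (matsubaraInt M i : ℝ) + 1) / ((2 * (2 * M) : ℕ) : ℝ) with hθ
  set c' : MatsubaraIdx M → ℂ := fun i => cexp (-(I * ((matsubaraFreq β M i * gridTime β (2 * (2 * M)) j₀ : ℝ) : ℂ))) * c i with hc'
  -- the exponent splits: `e^{iω_i(τ_{j₁} − τ_{j₀})} = e^{−iω_iτ_{j₀}}·e^{iθ_i j₁}`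
  have hexp : ∀ (j₁ : Fin (2 * (2 * M))) (i : MatsubaraIdx M),
      cexp (I * ((matsubaraFreq β M i * (gridTime β (2 * (2 * M)) j₁ - gridTime β (2 * (2 * M)) j₀) : ℝ) : ℂ)) =
        cexp (-(I * ((matsubaraFreq β M i * gridTime β (2 * (2 * M)) j₀ : ℝ) : ℂ))) * cexp (I * (θ i : ℂ) * ((j₁ : ℕ) : ℂ)) := by
    intro j₁ i
    rw [← Complex.exp_add]
    congr 1
    simp only [hθ, gridTime, matsubaraFreq]
    push_cast
    field_simp
    ring
  have hterm : ∀ (j₁ : Fin (2 * (2 * M))) (i : MatsubaraIdx M),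
      cexp (I * ((matsubaraFreq β M i * (gridTime β (2 * (2 * M)) j₁ - gridTime β (2 * (2 * M)) j₀) : ℝ) : ℂ)) * c i =
        c' i * cexp (I * (θ i : ℂ) * ((j₁ : ℕ) : ℂ)) := by
    intro j₁ i
    rw [hexp]
    simp only [hc']
    ring
  simp_rw [hterm]
  rw [Fin.sum_univ_eq_sum_range (fun j => ‖∑ i, c' i * cexp (I * (θ i : ℂ) * ((j : ℕ) : ℂ))‖ ^ 2) (2 * (2 * M))]
  -- the two hypotheses of the generic identity
  have hdiff : ∀ i i' : MatsubaraIdx M, ((θ i - θ i' : ℝ) : ℂ) * ((2 * (2 * M) : ℕ) : ℂ) =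
      ((matsubaraInt M i - matsubaraInt M i' : ℤ) : ℂ) * (2 * Real.pi) := by
    intro i i'
    simp only [hθ]
    push_cast
    field_simp
    ring
  have hper : ∀ i i' : MatsubaraIdx M, cexp (I * ((θ i - θ i' : ℝ) : ℂ) * ((2 * (2 * M) : ℕ) : ℕ)) = 1 := by
    intro i i'
    rw [show I * ((θ i - θ i' : ℝ) : ℂ) * (((2 * (2 * M) : ℕ) : ℕ) : ℂ) =
      ((matsubaraInt M i - matsubaraInt M i' : ℤ) : ℂ) * (2 * Real.pi * I) by
        rw [mul_assoc, hdiff]; ring]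
    exact Complex.exp_int_mul_two_pi_mul_I _
  have hsep : ∀ i i' : MatsubaraIdx M, i ≠ i' → cexp (I * ((θ i - θ i' : ℝ) : ℂ)) ≠ 1 := by
    intro i i' hii' h1
    obtain ⟨n, hn⟩ := Complex.exp_eq_one_iff.1 h1
    -- multiply by `4M` and compare with `hdiff`: `nᵢ − nᵢ′ = n·4M`
    have h2 : ((matsubaraInt M i - matsubaraInt M i' : ℤ) : ℂ) * (2 * Real.pi * I) =
        ((n : ℂ) * ((2 * (2 * M) : ℕ) : ℂ)) * (2 * Real.pi * I) := by
      calc ((matsubaraInt M i - matsubaraInt M i' : ℤ) : ℂ) * (2 * Real.pi * I)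
          = (I * ((θ i - θ i' : ℝ) : ℂ)) * ((2 * (2 * M) : ℕ) : ℂ) := by rw [mul_assoc I, hdiff]; ring
        _ = (n * (2 * Real.pi * I)) * ((2 * (2 * M) : ℕ) : ℂ) := by rw [hn]
        _ = ((n : ℂ) * ((2 * (2 * M) : ℕ) : ℂ)) * (2 * Real.pi * I) := by ring
    have h2πI : (2 * Real.pi * I : ℂ) ≠ 0 := by
      simp [Real.pi_ne_zero, Complex.I_ne_zero]
    have h3 := mul_right_cancel₀ h2πI h2
    have hdz : (matsubaraInt M i : ℤ) - matsubaraInt M i' = n * ((2 * (2 * M) : ℕ) : ℤ) := by exact_mod_cast h3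
    -- but `|nᵢ − nᵢ′| < 4M` and `nᵢ ≠ nᵢ′`
    have hlt : |(matsubaraInt M i : ℤ) - matsubaraInt M i'| < ((2 * (2 * M) : ℕ) : ℤ) := by
      simp only [matsubaraInt]
      have h1 := i.isLt; have h2 := i'.isLt
      rw [abs_lt]; constructor <;> push_cast <;> omega
    have hne : (matsubaraInt M i : ℤ) - matsubaraInt M i' ≠ 0 := by
      simp only [matsubaraInt]
      intro h0
      apply hii'
      ext; omega
    rw [hdz, abs_mul, Nat.abs_cast] at hlt
    have hn0 : n = 0 := by
      by_contra hn0
      have : (1 : ℤ) ≤ |n| := Int.one_le_abs hn0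
      have hNz : (0 : ℤ) < ((2 * (2 * M) : ℕ) : ℤ) := by exact_mod_cast hN
      nlinarith
    rw [hn0, zero_mul] at hdz
    exact hne hdz
  rw [sum_norm_sq_trigSum_eq c' θ hper hsep]
  simp only [hc', norm_cexp_neg_I_mul_ofReal_mul]

end Summit.HubbardSuperconductivity.HubbardSuperconductivity.Theorems.KLRegimeSplit

end
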